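import Summits.CriticalPhenomena.PercolationContinuityZ3.Theorems.PercLowPointHalfSpaceQuantitativeBGNFloorDefs
import Summits.CriticalPhenomena.PercolationContinuityZ3.Theorems.PercLowPointHalfSpaceQuantitativeBGNFloorDepthMono
import Summits.CriticalPhenomena.PercolationContinuityZ3.Theorems.PercLowPointHalfSpaceQuantitativeBGNFloorArmLocality
import Literature.Probability.Percolation.HalfSpaceFloorDilution
import Literature.Probability.Percolation.BondPercolationSymmetry
import Literature.Probability.Percolation.SharpnessDCTProofs
import HarnessLib

/-!
# `QuantitativeBGN` (stmt-CriticalPhenomena-0913), line `microscopic-floor-doubling-gain` — STUB 2 `stub_noFloor`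

Crux `Summit.CriticalPhenomena.PercolationContinuityZ3.Theses.PercLowPointHalfSpace.QuantitativeBGN`
(item stmt-CriticalPhenomena-0913), line `microscopic-floor-doubling-gain`, stub `stub_noFloor`
(STUB 2 of the line's skeleton `Cruxes/QuantitativeBGN/Lines/microscopic_floor_doubling_gain.lean`).

Statement proved: `∀ r j, gammaR r j ≤ armProbFloor r (j + 1) 0` — the critical depth-`j`
boundary one-arm probability `γ_r(j) = P_{p_c}(armFrom r j)` of
`Theorems/PercLowPointHalfSpaceQuantitativeBGNFloorDefs.lean` is at most the probability
`f_{j+1}(0)` of the depth-`(j+1)` arm under the floor-diluted half-space measure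
`floorDilutedPercolation 3 p_c 0` (`Literature/Probability/Percolation/HalfSpaceFloorDilution.lean`)
at floor density `0`: deleting the floor `{x₀ = 0}` but starting one level higher still dominates.

Proof (vertical shift + locality of product measures).
* Let `E₁ := (ω ↦ ω - e₀) ⁻¹' armFrom r j` (`e₀ = Pi.single 0 1`), the event that `ω` has an
  open arm from `(j+1)·e₀` inside the STRICT upper region `{x₀ ≥ 1}` reaching sup-distance `≥ r`.
  By translation invariance of `P_{p_c}` (`bondPercolation_real_preimage_shift`, Grimmett 1999
  §1.6), `P_{p_c}(E₁) = γ_r(j)` (`FloorNoFloor.real_preimage_shiftDown`).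
* `E₁` is determined by the pairs of points of `{x₀ ≥ 1}`
  (`FloorNoFloor.determinedBy_preimage_shiftDown`, transport of `determinedBy_armFrom_halfSpace`
  along the shift), and on these pairs the weights of `floorDilutedPercolation 3 p_c 0` and of
  `bondPercolation (zdGraph 3) p_c` agree (`p_c` on lattice edges — none of them is a floor edge —,
  `0` on non-edges: `FloorNoFloor.floorDilutedParam_zero_eq_indicator`), so the two product
  measures give `E₁` the same probability (`prodBernoulli_apply_eq_of_determinedBy`,
  `FloorNoFloor.floorDilutedPercolation_zero_real_eq`).
* `E₁ ⊆ armFrom r (j+1)` (`FloorNoFloor.preimage_shiftDown_subset_armFrom`): shifting back up,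
  `FloorDepthMono.armFrom_subset_preimage_shift` and `(ω - e₀) + e₀ = ω`.
Hence `γ_r(j) = P_{p_c}(E₁) = P^{ℍ}_{p_c,0}(E₁) ≤ P^{ℍ}_{p_c,0}(armFrom r (j+1)) = f_{j+1}(0)`
(`measureReal_mono`).
-/

noncomputable section

namespace Summit.CriticalPhenomena.PercolationContinuityZ3.Theorems

open MeasureTheory Literature.Probability.Percolation Literature.Probability.LatticeModels
open FloorDoubling

namespace FloorNoFloor

/-! Throughout, `ω ↦ ω - e₀` (`e₀ = Pi.single 0 1`) is the downward unit shift of bond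
configurations of `ℤ³`, the measurable equivalence
`BondConfig.relabel (sym2Equiv (Site.shift (-(Pi.single 0 1 : Site 3))))`; the event
`(ω ↦ ω - e₀) ⁻¹' armFrom r j` ("the configuration shifted DOWN by `e₀` has the depth-`j` arm")
says that `ω` itself has an open arm from `(j+1)·e₀` inside the strict upper region
`{x | 1 ≤ x 0}` reaching sup-distance `≥ r` from its start. -/

/-- **Translation invariance**: `P_p((ω ↦ ω - e₀) ⁻¹' armFrom r j) = P_p(armFrom r j)`
(`bondPercolation_real_preimage_shift`). [folklore] -/
theorem real_preimage_shiftDown (p : unitInterval) (r j : ℕ) :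
    (bondPercolation (zdGraph 3) p).real
        (BondConfig.relabel (sym2Equiv (Site.shift (-(Pi.single 0 1 : Site 3)))) ⁻¹'
          armFrom r j) =
      (bondPercolation (zdGraph 3) p).real (armFrom r j) :=
  bondPercolation_real_preimage_shift _ p (armFrom r j)

/-- `(ω ↦ ω - e₀) ⁻¹' armFrom r j` is measurable (preimage of the measurable `armFrom r j` under
a measurable equivalence). [folklore] -/
theorem measurableSet_preimage_shiftDown (r j : ℕ) :
    MeasurableSet
      (BondConfig.relabel (sym2Equiv (Site.shift (-(Pi.single 0 1 : Site 3)))) ⁻¹'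
        armFrom r j) :=
  (measurableSet_armFrom r j).preimage (BondConfig.relabel _).measurable

/-- Shifting down by `v` and then up by `v` is the identity on configurations. [folklore] -/
theorem relabel_shift_relabel_shift_neg (v : Site 3) (ω : BondConfig (Site 3)) :
    BondConfig.relabel (sym2Equiv (Site.shift v))
        (BondConfig.relabel (sym2Equiv (Site.shift (-v))) ω) = ω := by
  ext z
  induction z using Sym2.ind with
  | h a b =>
    rw [BondConfig.mem_relabel_iff, BondConfig.mem_relabel_iff]
    simp

/-- **`(ω ↦ ω - e₀) ⁻¹' armFrom r j ⊆ armFrom r (j+1)`**: if `ω - e₀` has the depth-`j` arm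
then `ω = (ω - e₀) + e₀` has the depth-`(j+1)` arm
(`FloorDepthMono.armFrom_subset_preimage_shift`). [folklore] -/
theorem preimage_shiftDown_subset_armFrom (r j : ℕ) :
    BondConfig.relabel (sym2Equiv (Site.shift (-(Pi.single 0 1 : Site 3)))) ⁻¹' armFrom r j ⊆
      armFrom r (j + 1) := by
  intro ω hω
  have h := FloorDepthMono.armFrom_subset_preimage_shift r j hω
  rwa [Set.mem_preimage, relabel_shift_relabel_shift_neg] at h

/-- A pair of points lies in `{x₀ ≥ 0}` iff its upward shift by `e₀` lies in `{x₀ ≥ 1}`.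
[folklore] -/
theorem mem_sym2_halfSpace_iff_symm_mem (z : Sym2 (Site 3)) :
    z ∈ {x : Site 3 | 0 ≤ x 0}.sym2 ↔
      (sym2Equiv (Site.shift (-(Pi.single 0 1 : Site 3)))).symm z ∈
        {x : Site 3 | 1 ≤ x 0}.sym2 := by
  induction z using Sym2.ind with
  | h a b =>
    simp only [sym2Equiv_symm, sym2Equiv_mk, Site.shift_symm_apply, Set.mk_mem_sym2_iff,
      Set.mem_setOf_eq, Pi.sub_apply, Pi.neg_apply, Pi.single_eq_same]
    omega

/-- **`(ω ↦ ω - e₀) ⁻¹' armFrom r j` is determined by the pairs of points of the strict upper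
region `{x₀ ≥ 1}`** (transport of `determinedBy_armFrom_halfSpace` along the shift). [folklore] -/
theorem determinedBy_preimage_shiftDown (r j : ℕ) :
    DeterminedBy
      (BondConfig.relabel (sym2Equiv (Site.shift (-(Pi.single 0 1 : Site 3)))) ⁻¹' armFrom r j)
      ({x : Site 3 | 1 ≤ x 0}.sym2) := by
  rw [determinedBy_iff]
  intro ω ω' hK
  simp only [Set.mem_preimage]
  refine (determinedBy_iff _ _).1 (determinedBy_armFrom_halfSpace r j) _ _ ?_
  ext z
  have key := Set.ext_iff.1 hK ((sym2Equiv (Site.shift (-(Pi.single 0 1 : Site 3)))).symm z)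
  simp only [Set.mem_inter_iff] at key
  simp only [Set.mem_inter_iff, BondConfig.mem_relabel_iff, mem_sym2_halfSpace_iff_symm_mem z]
  exact key

/-- **At floor density `0` the weights agree with those of `bondPercolation (zdGraph 3) p` on all
pairs of points of `{x₀ ≥ 1}`**: such a pair is never a floor edge, so a lattice edge gets weight
`p` and a non-edge weight `0`. [folklore] -/
theorem floorDilutedParam_zero_eq_indicator (p : unitInterval) {e : Sym2 (Site 3)}
    (he : e ∈ {x : Site 3 | 1 ≤ x 0}.sym2) [Decidable (e ∈ (zdGraph 3).edgeSet)] :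
    floorDilutedParam 3 p 0 e = if e ∈ (zdGraph 3).edgeSet then p else 0 := by
  have hsub : ∀ z ∈ e, 1 ≤ z 0 := fun z hz => Set.mem_sym2_iff_subset.1 he hz
  split_ifs with heE
  · have hH : e ∈ halfSpaceEdgeSet 3 := ⟨heE, fun z hz => le_trans zero_le_one (hsub z hz)⟩
    have hF : e ∉ floorEdgeSet 3 := fun hf => by
      have h1 := hsub _ (Sym2.out_fst_mem e)
      have h2 := hf.2 _ (Sym2.out_fst_mem e)
      omega
    exact floorDilutedParam_of_not_mem_floorEdgeSet p 0 hH hF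
  · exact floorDilutedParam_of_not_mem_halfSpaceEdgeSet p 0 fun h => heE h.1

/-- **At floor density `0` the floor-diluted measure agrees with `P_p` on every measurable event
determined by the pairs of points of `{x₀ ≥ 1}`** (two product measures with the same weights
there: `prodBernoulli_apply_eq_of_determinedBy`). [folklore] -/
theorem floorDilutedPercolation_zero_apply_eq (p : unitInterval) {A : Set (BondConfig (Site 3))}
    (hA : DeterminedBy A {x : Site 3 | 1 ≤ x 0}.sym2) (hAm : MeasurableSet A) :
    floorDilutedPercolation 3 p 0 A = bondPercolation (zdGraph 3) p A := by
  classical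
  rw [floorDilutedPercolation, bondPercolation, ← prodBernoulli_indicator_holds]
  exact prodBernoulli_apply_eq_of_determinedBy _ _
    (fun e he => floorDilutedParam_zero_eq_indicator p he) hA hAm

/-- Real-valued form of `floorDilutedPercolation_zero_apply_eq`. [folklore] -/
theorem floorDilutedPercolation_zero_real_eq (p : unitInterval) {A : Set (BondConfig (Site 3))}
    (hA : DeterminedBy A {x : Site 3 | 1 ≤ x 0}.sym2) (hAm : MeasurableSet A) :
    (floorDilutedPercolation 3 p 0).real A = (bondPercolation (zdGraph 3) p).real A := by
  rw [Measure.real, Measure.real, floorDilutedPercolation_zero_apply_eq p hA hAm]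

end FloorNoFloor

open FloorNoFloor in
/-- **STUB 2 of line `microscopic-floor-doubling-gain` (`NoFloor`).** `γ_r(j) ≤ f_{j+1}(0)` for all
`r j`: the critical depth-`j` arm probability is dominated by the depth-`(j+1)` arm probability
under the half-space measure with the floor deleted. Indeed `γ_r(j) = P_{p_c}(E₁)` for
`E₁ = (ω ↦ ω - e₀) ⁻¹' armFrom r j` (translation invariance), `= P^{ℍ}_{p_c,0}(E₁)` (the event
lives on the pairs of `{x₀ ≥ 1}`, where the two product measures have the same weights),
`≤ P^{ℍ}_{p_c,0}(armFrom r (j+1)) = f_{j+1}(0)` (`E₁ ⊆ armFrom r (j+1)`). [folklore] -/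
theorem stub_noFloor : ∀ r j : ℕ, gammaR r j ≤ armProbFloor r (j + 1) 0 := by
  intro r j
  unfold gammaR armProbFloor
  rw [← real_preimage_shiftDown (criticalProbI 3) r j,
    ← floorDilutedPercolation_zero_real_eq (criticalProbI 3) (determinedBy_preimage_shiftDown r j)
      (measurableSet_preimage_shiftDown r j)]
  exact measureReal_mono (preimage_shiftDown_subset_armFrom r j)

end Summit.CriticalPhenomena.PercolationContinuityZ3.Theorems

end
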